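import Mathlib
import Summits.ValiantsHypothesis.ValiantsHypothesis.Theses.ValuativeGCT
import Summits.ValiantsHypothesis.ValiantsHypothesis.Theorems.ValuativeGCTValuativeBound
import Summits.ValiantsHypothesis.ValiantsHypothesis.Theorems.ValuativeGCTValuativeFlipStabInvLeExplicit
import Summits.ValiantsHypothesis.ValiantsHypothesis.Theorems.ValuativeGCTValuativeFlipFourRowSliceBound
import Summits.ValiantsHypothesis.ValiantsHypothesis.Theorems.ValuativeGCTValuativeFlipFourRowHwspSupport

/-!
# Det-orbit-closure multiplicity bound at four-row shapes

Det side of line `four-row-count` for crux `ValuativeGCT.ValuativeFlip` (stmt-ValiantsHypothesis-12624),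
assembled from the landed pieces: for `m ≥ 2`, every degree `δ` and every partition `λ ⊢ mδ` with
AT MOST FOUR parts,

* `fourRow_truncT_finrank_le` — every valuative truncation `T_U(λ)` of the crux (any centre `U`, any
  rank bound `r`) has `dim T_U(λ) ≤ (mδ + 1)^(2m² + m)`: `T_U(λ) ⊆ Hom_{mδ} ⊓ STAB ⊓ HWSP(λ*)`
  `⊆ Hom ⊓ SAND ⊓ HWSP(λ*)` (`stub_stabInv_le_explicit`) `⊆ Hom ⊓ SAND ⊓ ROWS₄`
  (`fourRow_detMult_le_fourRow`: semi-invariants of a `≤ 4`-row weight are functions of the four kept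
  rows) and the four-row slice bound `stub_fourRowSliceBound`;
* `fourRow_detOrbitMultiplicity_le` — consequently the multiplicity of `λ*` in the coordinate ring of
  the determinant orbit closure is polynomially bounded in `δ` with exponent `2m² + m`:
  `K_m(λ*) = mult_{λ*} ℂ[Δ(det_m)] ≤ (mδ + 1)^(2m² + m)` (`ValuativeBound_proof` at `U = ⊥`).

This is the det half of the four-row census (`headCensus_of` of the line compares it with the per
side's `C(δ + N, N)`, `N = 2m² + m + 1`).  No named facts; everything used is landed in tree.
-/

-- `Summit.ValiantsHypothesis.ValiantsHypothesis.…` is the tree's mandated single-conjunct layout (Sub = Summit).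
set_option linter.dupNamespace false

namespace Summit.ValiantsHypothesis.ValiantsHypothesis.Theorems.ValuativeFlip

open MvPolynomial
open scoped BigOperators Matrix
open Literature.NumberTheory.DiophantineGeometry
open Literature.Computability.AlgebraicComplexity

noncomputable section

/-- **Uniform bound for the valuative truncation at four-row shapes.**  For `m ≥ 2`, every centre
`U`, rank bound `r`, degree `δ` and `λ ⊢ mδ` with at most four parts, the crux's truncation
`T_U(λ) = Hom_{mδ} ⊓ I(L_U)^{δ(m-r)} ⊓ STAB(det_m) ⊓ HWSP(λ*)` has dimension at most
`(mδ + 1)^(2m² + m)` (drop the ideal power; `STAB ≤ SAND`; semi-invariants of weight `λ*` live on the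
four kept rows; four-row slice bound). [this route: four-row census, det side] -/
theorem fourRow_truncT_finrank_le (m : ℕ) (hm : 2 ≤ m) (U : Submodule ℂ (MatIdx m → ℂ)) (r δ : ℕ)
    (lam : Nat.Partition (m * δ)) (hlam : lam.parts.card ≤ 4) :
    Module.finrank ℂ ↥(MvPolynomial.homogeneousSubmodule (MatIdx m × MatIdx m) ℂ (m * δ) ⊓
        ((MvPolynomial.vanishingIdeal ℂ {p : MatIdx m × MatIdx m → ℂ | ∀ j : MatIdx m, (fun i => p (j, i)) ∈ U}) ^
            (δ * (m - r))).restrictScalars ℂ ⊓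
        (⨅ (M : Matrix (MatIdx m) (MatIdx m) ℂ) (_ : linSubst (MatIdx m) ℂ M (detFormLex ℂ m) = detFormLex ℂ m),
          LinearMap.ker ((MvPolynomial.aeval (R := ℂ) fun p : MatIdx m × MatIdx m =>
              ∑ l : MatIdx m, M l p.2 • MvPolynomial.X (p.1, l)).toLinearMap -
            LinearMap.id (R := ℂ) (M := MvPolynomial (MatIdx m × MatIdx m) ℂ))) ⊓
        (⨅ (g : Matrix.GeneralLinearGroup (MatIdx m) ℂ) (_ : IsUpperTriangular g),
          LinearMap.ker ((MvPolynomial.aeval (R := ℂ) fun p : MatIdx m × MatIdx m =>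
              ∑ l : MatIdx m, ((g⁻¹ : Matrix.GeneralLinearGroup (MatIdx m) ℂ) : Matrix (MatIdx m) (MatIdx m) ℂ) p.1 l •
                MvPolynomial.X (l, p.2)).toLinearMap -
            weightChar ((Weight.dualOfPartition (m * m) lam).toMatIdx : Weight (MatIdx m)) g •
              LinearMap.id (R := ℂ) (M := MvPolynomial (MatIdx m × MatIdx m) ℂ)))) ≤
      (m * δ + 1) ^ (2 * m ^ 2 + m) := by
  haveI : Module.Finite ℂ ↥(MvPolynomial.homogeneousSubmodule (MatIdx m × MatIdx m) ℂ (m * δ)) :=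
    Module.Finite.iff_fg.mpr (MvPolynomial.homogeneousSubmodule_fg (MatIdx m × MatIdx m) ℂ (m * δ))
  haveI : Module.Finite ℂ ↥(MvPolynomial.homogeneousSubmodule (MatIdx m × MatIdx m) ℂ (m * δ) ⊓
      (⨅ (P : Matrix (Fin m) (Fin m) ℂ) (Q : Matrix (Fin m) (Fin m) ℂ) (_ : P.det = 1) (_ : Q.det = 1),
        LinearMap.ker ((MvPolynomial.aeval fun p : MatIdx m × MatIdx m =>
            ∑ l : MatIdx m, (P (ofLex p.2).1 (ofLex l).1 * Q (ofLex l).2 (ofLex p.2).2) •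
              (MvPolynomial.X (p.1, l) : MvPolynomial (MatIdx m × MatIdx m) ℂ)).toLinearMap -
          (LinearMap.id : MvPolynomial (MatIdx m × MatIdx m) ℂ →ₗ[ℂ] MvPolynomial (MatIdx m × MatIdx m) ℂ))) ⊓
      Subalgebra.toSubmodule (MvPolynomial.supported ℂ
        {p : MatIdx m × MatIdx m | m * m ≤ (((matIdxEquiv m).symm p.1 : Fin (m * m)) : ℕ) + 4})) :=
    Submodule.finiteDimensional_of_le (inf_le_left.trans inf_le_left)
  refine (Submodule.finrank_mono ?_).trans (stub_fourRowSliceBound m hm (m * δ))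
  refine le_trans (le_inf (le_inf (inf_le_left.trans (inf_le_left.trans inf_le_left))
    ((inf_le_left.trans inf_le_right).trans ((stub_stabInv_le_explicit m).trans inf_le_left))) inf_le_right) ?_
  exact fourRow_detMult_le_fourRow m (m * δ) lam hlam

/-- **Det-orbit-closure multiplicity bound at four-row shapes.**  For `m ≥ 2`, every degree `δ` and
every `λ ⊢ mδ` with at most four parts, the multiplicity of the dual weight `λ*` in the coordinate
ring of the orbit closure of `det_m` satisfies `K_m(λ*) ≤ (mδ + 1)^(2m² + m)`:
`K_m(λ*) ≤ dim T_⊥(λ)` by the route's valuative bound (`ValuativeBound_proof`, BLMW 2011 Prop. 5.2.1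
at `U = 0`) and `fourRow_truncT_finrank_le`.  Polynomial growth of exponent `2m² + m` in `δ`, against
the per side's `C(δ + 2m² + m + 1, 2m² + m + 1)` on the linear head of the window.
[this route: four-row census, det side; BLMW 2011 §5.2] -/
theorem fourRow_detOrbitMultiplicity_le (m : ℕ) [NeZero m] (hm : 2 ≤ m) (δ : ℕ)
    (lam : Nat.Partition (m * δ)) (hlam : lam.parts.card ≤ 4) :
    orbitMultiplicity ℂ (detFormLex ℂ m) m ((Weight.dualOfPartition (m * m) lam).toMatIdx : Weight (MatIdx m)) ≤
      (m * δ + 1) ^ (2 * m ^ 2 + m) := by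
  have hU : ∀ u ∈ (⊥ : Submodule ℂ (MatIdx m → ℂ)), (Matrix.of fun a b : Fin m => u (toLex (a, b))).rank ≤ 0 := by
    intro u hu
    rw [Submodule.mem_bot] at hu
    subst hu
    have h0 : (Matrix.of fun a b : Fin m => (0 : MatIdx m → ℂ) (toLex (a, b))) = 0 := by
      ext a b
      simp
    rw [h0, Matrix.rank_zero]
  have hcard : lam.parts.card ≤ m * m := hlam.trans (by nlinarith)
  exact (Summit.ValiantsHypothesis.ValiantsHypothesis.Theorems.ValuativeBound.ValuativeBound_proof
    m ⊥ 0 hU δ lam hcard).trans (fourRow_truncT_finrank_le m hm ⊥ 0 δ lam hlam)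

end

end Summit.ValiantsHypothesis.ValiantsHypothesis.Theorems.ValuativeFlip
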